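import Summits.QuantumFields.BalabanUV.Beta.GAN24.ContactGaugeStaircase
import Summits.QuantumFields.BalabanUV.Beta.GAN24.CombLegFaceSawtoothBlockL1
import Summits.QuantumFields.BalabanUV.Beta.GAN24.StaircasePairing

/-!
# `BalabanUV.Beta.GAN24.CombContactGaugeStaircase` — binder row G-an2-4 ∕ (CONV-C), TRANSFER-III, the (III′) S-slot (b) of the END `CombChargeRowsClosed`:
# road-P2's M.104 `CombSRowsOfContactLetters` reads (b) from SIX contact letters; this is part 1 of the FIRST of them, the (III′) WILSON CONTACT END `hCT′` —
# **THE BOND GAUGE FUNCTION `λ′` OF THE CONJUGATED (COMB-CHART) COMPOSITE LEG IS A STAIRCASE SUM `λ′_{μz} = Σ_{s ≤ k+1} G′ s ∘ blk (Lc^s)` WITH GEOMETRIC PER-SCALE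
# ENVELOPES `|G′ s (blk (Lc^s) u)| ≤ α₁·Lc^s·e^{−κ₀‖quo N u − z‖∞}`** — the (III′) twin of MY g58 (E) `ContactGaugeStaircase`, ONE SCALE LONGER: the (E) staircase of
# `λ = Ψ − bmGauge` (scales `0 … k`) PLUS the OWNER gan24-p1 g47's face staircase of `PsiFace` (`CombLegFaceSawtoothBlockL1.PsiFace_apply_eq_sum`: the level-`i` face
# potential is block-constant at scale `Lc^{i+1}`, scales `1 … k+1`), with `α₁ = 8·Lc·C·(Lc^{5(k+1)})⁻¹ + F·(1 + 8·Lc·(e^{κ₀}+1))·C·(Lc^{5(k+1)})⁻¹` (`F ≥ faceWtSum r Lc`).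

NOT IN PRINT; OUR BOOKKEEPING (G-an2-4 formalisation swarm, leaf prover `b2b-balaban-gan24-formalise-leaf-01`, gen 89; [folklore] finite-sum bookkeeping BY NAME over MY (E)
`gauge_eq_staircase ∕ abs_gaugePiece_le` and the OWNER's `PsiFace_apply_eq_sum ∕ abs_facePotential_legChain_single_le`; 0 `def`, 0 cited facts, 0 `def … : Prop`, 0 sorry).
HONEST FRAMING (cell contract, verbatim): «discharging `BetaPertH` makes Bałaban's UV stability UNCONDITIONAL — a real constructive-QFT result; it is NOT the continuum
limit and NOT the Clay problem.»  HONEST DEPENDENCY (verbatim): «continuum YM on T⁴ ⇐ BetaPertH ∧ nine spine estimates (0/9 proved); BetaPertH ⇐ (D1) ∧ (D4) ∧ CAP+tail;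
G-an2-4 gates asym, D1 and NE2/3/4.»

WHAT (`λ′ μ z u = Psi ρ Lc m k (delta1 μ z) u + PsiFace r ρ Lc m k (delta1 μ z) u − bmGaugeAt ρ (respStep (Lc^m) (Lc^(m+k+1)) μ z) Lc u`, M.59 `CombContactKernelCells` §1):
* §1 (generic `d`, every `r ρ m k μ z u`) **`combGauge_eq_staircase`**: `λ′ μ z u = Σ_{s ∈ range (k+2)} G′ s (blk (Lc^s) u)`, the piece family ONE lambda: the (E) piece for
  `s ≤ k` (else `0`) PLUS, for `s ≥ 1`, `(Lc^{(d+1)(s−1)})⁻¹·|box Lc|⁻¹·ζ_S (legAct (legChain R (m+s−1) (k−(s−1))) (delta1 μ z))` (the face potential of the level-`(s−1)`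
  partial-chain output, whose `blk Lc`-reading sits at scale `Lc^s`).
* §2 (`d = 3`, in-block roots `r, rr`, parametric in leaf-12's (N1) data `κ₀, C` and a face letter `F ≥ faceWtSum r Lc`) **`abs_combGaugePiece_le`**: for ALL `s ≤ k+1` and `u`,
  `|G′ s (blk (Lc^s) u)| ≤ α₁·Lc^s·e^{−κ₀‖quo (Lc^(k+1)) u − z‖∞}`; **`abs_combGauge_le`**: `|λ′ μ z u| ≤ 2·α₁·Lc^{k+1}·e^{−κ₀‖quo (Lc^(k+1)) u − z‖∞}` — exactly the hypotheses
  `hψ ∕ hG₁ ∕ a s ≤ α·Lc^s` of the OWNER's `StaircasePairing.abs_pairing_le_sum ∕ sum_weights_le_of_geometric` (staircase length `k+1`, `N = Lc^{k+1}`, `Lc^s ∣ N` for `s ≤ k+1`).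
NO new estimate; discharges NOTHING of (hS, hSall); NEVER «G-an2-4 closed» as (CONV-C); NOT D1, NOT BetaPertH, NOT continuum, NOT Clay.  2026-08-28; no existing file touched.
-/

noncomputable section

open Finset
open scoped BigOperators
open Literature.MathematicalPhysics.QuantumFieldTheory
open Literature.MathematicalPhysics.QuantumFieldTheory.LatticeForm (quo)
open Literature.MathematicalPhysics.QuantumFieldTheory.Balaban1983to89
open Literature.MathematicalPhysics.QuantumFieldTheory.Balaban1983to89.Beta
open B4ContourShift (supNorm supNorm_nonneg)
open AffineAveraging (Form0 Form1 Site box toSite)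
open AveragingContours (blk)
open KKTFluctuationKernel (delta1)
open BalabanCompositeJets (respStep)
open Summit.QuantumFields.BalabanUV.Beta.AxialProjectorBlockMean (bmGaugeAt)
open Summit.QuantumFields.BalabanUV.Beta.SymCorrectorForms (zetaS)
open Summit.QuantumFields.BalabanUV.Beta.SymCorrectorFace (faceWtSum faceWtSum_nonneg)
open Summit.QuantumFields.BalabanUV.Beta.GAN24.Push4Iter (legChain)
open Summit.QuantumFields.BalabanUV.Beta.GAN24.RespStepBmDecompLegs (legAct)
open Summit.QuantumFields.BalabanUV.Beta.GAN24.RespStepBmDecompExact (respStepBmSeq blk_blk_pow)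
open Summit.QuantumFields.BalabanUV.Beta.GAN24.RespStepBmDecompPsi (Psi)
open Summit.QuantumFields.BalabanUV.Beta.GAN24.DressedLegEnvelope (blk_pow_blk_pow single_eq_delta1)
open Summit.QuantumFields.BalabanUV.Beta.GAN24.StaircaseFaces (blk_one)
open Summit.QuantumFields.BalabanUV.Beta.GAN24.StaircasePairing (sum_pow_le)
open Summit.QuantumFields.BalabanUV.Beta.GAN24.ContactGaugeStaircase (gauge_eq_staircase abs_gaugePiece_le)
open Summit.QuantumFields.BalabanUV.Beta.GAN24.CombLegChainGauge (PsiFace facePotential facePotential_apply)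
open Summit.QuantumFields.BalabanUV.Beta.GAN24.CombLegFaceSawtoothBlockL1 (PsiFace_apply_eq_sum abs_facePotential_legChain_single_le)

namespace Summit.QuantumFields.BalabanUV.Beta.GAN24.CombContactGaugeStaircase

variable {d : ℕ} {Lc : ℕ} [NeZero Lc]

/-! ## §1 The staircase presentation of the conjugated bond gauge function (generic `d`) -/

/-- NOT IN PRINT; OUR BOOKKEEPING.  **THE CONJUGATED BOND GAUGE FUNCTION IS A STAIRCASE SUM, ONE SCALE LONGER THAN (E)'s** (generic `d`, every root offset `r` of `Ψ̂_S`,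
every dressing root `ρ`, every `m k μ z u`): `λ′ μ z u = Σ_{s < k+2} G′ s (blk (Lc^s) u)` — MY (E) `gauge_eq_staircase` (scales `≤ k`) ⊕ the OWNER's `PsiFace_apply_eq_sum`
read one scale up (`facePotential_apply`, `blk Lc ∘ blk (Lc^i) = blk (Lc^{i+1})`). -/
theorem combGauge_eq_staircase (r : Fin (d + 1) → ℕ) (ρ : Fin (d + 1) → ℤ) (m k : ℕ) (μ : Fin (d + 1)) (z u : Site (d + 1)) :
    Psi ρ Lc m k (delta1 μ z) u + PsiFace r ρ Lc m k (delta1 μ z) u - bmGaugeAt ρ (respStep (d := d) (Lc ^ m) (Lc ^ (m + k + 1)) μ z) Lc u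
      = ∑ s ∈ Finset.range (k + 1 + 1),
          (fun (s : ℕ) (y : Site (d + 1)) =>
            (if s ≤ k then
                (if s = 0 then -bmGaugeAt ρ (respStep (d := d) (Lc ^ m) (Lc ^ (m + k + 1)) μ z) Lc y
                 else -(((Lc : ℝ) ^ ((d + 1) * s))⁻¹ *
                   bmGaugeAt ρ (legAct (respStep (d := d) (Lc ^ (m + s)) (Lc ^ (m + k + 1))) (delta1 μ z)) Lc y))
              else 0)
            + (if s = 0 then 0
               else ((Lc : ℝ) ^ ((d + 1) * (s - 1)))⁻¹ * ((((box (d + 1) Lc).card : ℝ))⁻¹ *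
                 zetaS (toSite r) Lc (legAct (legChain (respStepBmSeq (d := d) ρ Lc) (m + (s - 1)) (k - (s - 1))) (delta1 μ z)) y)))
            s (blk (Lc ^ s) u) := by
  rw [show Psi ρ Lc m k (delta1 μ z) u + PsiFace r ρ Lc m k (delta1 μ z) u - bmGaugeAt ρ (respStep (d := d) (Lc ^ m) (Lc ^ (m + k + 1)) μ z) Lc u
      = (Psi ρ Lc m k (delta1 μ z) u - bmGaugeAt ρ (respStep (d := d) (Lc ^ m) (Lc ^ (m + k + 1)) μ z) Lc u) + PsiFace r ρ Lc m k (delta1 μ z) u by ring,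
    gauge_eq_staircase ρ m k μ z u, PsiFace_apply_eq_sum ρ k m (delta1 μ z) u]
  simp only [Finset.sum_add_distrib]
  congr 1
  · -- the (E) part: the extra top scale carries nothing
    rw [Finset.sum_range_succ _ (k + 1), if_neg (show ¬ (k + 1 ≤ k) by omega), add_zero]
    exact Finset.sum_congr rfl fun s hs => by rw [if_pos (Nat.lt_succ_iff.1 (Finset.mem_range.1 hs))]
  · -- the face part: nothing at scale `0`, the level-`i` face potential at scale `i+1`
    rw [Finset.sum_range_succ' _ (k + 1)]
    simp only [Nat.succ_ne_zero, ↓reduceIte, add_zero, Nat.add_sub_cancel]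
    exact Finset.sum_congr rfl fun i _ => by rw [facePotential_apply, blk_blk_pow]

/-! ## §2 `d = 3`: geometric per-scale envelopes of the pieces; the plain envelope of `λ′` -/

section Four

variable {κ₀ C F : ℝ} (hκ : 0 ≤ κ₀) (hC : 0 ≤ C)
  (hN1 : ∀ (m k : ℕ) (μ : Fin (3 + 1)) (z : Site (3 + 1)) (l'' : Fin (3 + 1)) (w' : Site (3 + 1)),
    |respStep (d := 3) (Lc ^ m) (Lc ^ (m + k + 1)) μ z l'' w'| ≤
      C * ((Lc : ℝ) ^ (5 * (k + 1)))⁻¹ * Real.exp (-(κ₀ * supNorm (quo (Lc ^ (k + 1)) w' - z))))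
  {r : Fin (3 + 1) → ℕ} (hr : r ∈ box (3 + 1) Lc) {rr : Fin (3 + 1) → ℕ} (hrr : rr ∈ box (3 + 1) Lc) (hF : faceWtSum r Lc ≤ F)
include hκ hC hN1 hr hrr hF

/-- NOT IN PRINT; OUR BOOKKEEPING.  **EVERY PIECE OF THE CONJUGATED STAIRCASE KEEPS THE SOURCE-SCALE ENVELOPE WITH A GEOMETRIC LETTER** (`d = 3`, in-block roots `r, rr`,
`ρ = toSite rr`; parametric in leaf-12's (N1) data `κ₀, C` and a face letter `F ≥ faceWtSum r Lc`): for ALL `m k μ z`, all `s ≤ k+1` and all `u`,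
`|G′ s (blk (Lc^s) u)| ≤ (α₀ + F·(1 + 8·Lc·(e^{κ₀}+1))·C·(Lc^{5(k+1)})⁻¹)·Lc^s·e^{−κ₀‖quo (Lc^(k+1)) u − z‖∞}`, `α₀ = 8·Lc·C·(Lc^{5(k+1)})⁻¹` — the (E) piece by MY
`abs_gaugePiece_le` (zero at `s = k+1`), the face piece by the OWNER's `abs_facePotential_legChain_single_le` at base `m+i`, length `k−i` (`(Lc^{5(k−i+1)})⁻¹·(Lc^{4i})⁻¹ =
Lc^i·(Lc^{5(k+1)})⁻¹ ≤ Lc^{i+1}·(Lc^{5(k+1)})⁻¹`; the label `quo (Lc^{k−i+1}) ∘ blk (Lc^i) = quo (Lc^{k+1})`). -/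
theorem abs_combGaugePiece_le (m k : ℕ) (μ : Fin (3 + 1)) (z : Site (3 + 1)) {s : ℕ} (hs : s ≤ k + 1) (u : Site (3 + 1)) :
    |(fun (s : ℕ) (y : Site (3 + 1)) =>
        (if s ≤ k then
            (if s = 0 then -bmGaugeAt (toSite rr) (respStep (d := 3) (Lc ^ m) (Lc ^ (m + k + 1)) μ z) Lc y
             else -(((Lc : ℝ) ^ ((3 + 1) * s))⁻¹ *
               bmGaugeAt (toSite rr) (legAct (respStep (d := 3) (Lc ^ (m + s)) (Lc ^ (m + k + 1))) (delta1 μ z)) Lc y))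
          else 0)
        + (if s = 0 then 0
           else ((Lc : ℝ) ^ ((3 + 1) * (s - 1)))⁻¹ * ((((box (3 + 1) Lc).card : ℝ))⁻¹ *
             zetaS (toSite r) Lc (legAct (legChain (respStepBmSeq (d := 3) (toSite rr) Lc) (m + (s - 1)) (k - (s - 1))) (delta1 μ z)) y)))
        s (blk (Lc ^ s) u)|
      ≤ (8 * (Lc : ℝ) * C * ((Lc : ℝ) ^ (5 * (k + 1)))⁻¹ + F * ((1 + 8 * (Lc : ℝ) * (Real.exp κ₀ + 1)) * C * ((Lc : ℝ) ^ (5 * (k + 1)))⁻¹)) *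
          (Lc : ℝ) ^ s * Real.exp (-(κ₀ * supNorm (quo (Lc ^ (k + 1)) u - z))) := by
  have hL0 : (0 : ℝ) < Lc := by exact_mod_cast Nat.pos_of_ne_zero (NeZero.ne Lc)
  have hL1 : (1 : ℝ) ≤ Lc := by exact_mod_cast Nat.one_le_iff_ne_zero.2 (NeZero.ne Lc)
  have hF0 : 0 ≤ F := (faceWtSum_nonneg r Lc).trans hF
  set E : ℝ := Real.exp (-(κ₀ * supNorm (quo (Lc ^ (k + 1)) u - z))) with hE
  have hE0 : 0 ≤ E := (Real.exp_pos _).le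
  set α0 : ℝ := 8 * (Lc : ℝ) * C * ((Lc : ℝ) ^ (5 * (k + 1)))⁻¹ with hα0
  set φ1 : ℝ := F * ((1 + 8 * (Lc : ℝ) * (Real.exp κ₀ + 1)) * C * ((Lc : ℝ) ^ (5 * (k + 1)))⁻¹) with hφ1
  have hα00 : 0 ≤ α0 := by positivity
  have hφ10 : 0 ≤ φ1 := by positivity
  -- the (E) part
  have hA : |(if s ≤ k then
            (if s = 0 then -bmGaugeAt (toSite rr) (respStep (d := 3) (Lc ^ m) (Lc ^ (m + k + 1)) μ z) Lc (blk (Lc ^ s) u)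
             else -(((Lc : ℝ) ^ ((3 + 1) * s))⁻¹ *
               bmGaugeAt (toSite rr) (legAct (respStep (d := 3) (Lc ^ (m + s)) (Lc ^ (m + k + 1))) (delta1 μ z)) Lc (blk (Lc ^ s) u)))
          else 0)| ≤ α0 * (Lc : ℝ) ^ s * E := by
    by_cases hsk : s ≤ k
    · rw [if_pos hsk]
      have h := abs_gaugePiece_le (Lc := Lc) hN1 hrr m k μ z hsk u
      rw [← hE] at h
      exact h
    · rw [if_neg hsk, abs_zero]; positivity
  -- the face part
  have hB : |(if s = 0 then 0
           else ((Lc : ℝ) ^ ((3 + 1) * (s - 1)))⁻¹ * ((((box (3 + 1) Lc).card : ℝ))⁻¹ *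
             zetaS (toSite r) Lc (legAct (legChain (respStepBmSeq (d := 3) (toSite rr) Lc) (m + (s - 1)) (k - (s - 1))) (delta1 μ z)) (blk (Lc ^ s) u)))|
        ≤ φ1 * (Lc : ℝ) ^ s * E := by
    rcases Nat.eq_zero_or_pos s with h0 | hpos
    · subst h0; rw [if_pos rfl, abs_zero]; positivity
    · obtain ⟨i, rfl⟩ : ∃ i, s = i + 1 := ⟨s - 1, by omega⟩
      have hik : i ≤ k := by omega
      rw [if_neg (Nat.succ_ne_zero i), Nat.add_sub_cancel, ← blk_blk_pow, ← facePotential_apply, ← single_eq_delta1, abs_mul, abs_inv, abs_pow, abs_of_pos hL0]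
      have h := abs_facePotential_legChain_single_le hκ hC hN1 hr hrr (m + i) (k - i) μ z (blk (Lc ^ i) u)
      have hlab : quo (Lc ^ (k - i + 1)) (blk (Lc ^ i) u) = quo (Lc ^ (k + 1)) u := by
        show blk (Lc ^ (k - i + 1)) (blk (Lc ^ i) u) = blk (Lc ^ (k + 1)) u
        rw [blk_pow_blk_pow, show i + (k - i + 1) = k + 1 by omega]
      rw [hlab, ← hE] at h
      have hB0 : 0 ≤ (1 + 8 * (Lc : ℝ) * (Real.exp κ₀ + 1)) * C * ((Lc : ℝ) ^ (5 * (k - i + 1)))⁻¹ * E := by positivity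
      have h' := h.trans (mul_le_mul_of_nonneg_right hF hB0)
      have e : ((Lc : ℝ) ^ ((3 + 1) * i))⁻¹ * ((Lc : ℝ) ^ (5 * (k - i + 1)))⁻¹ = ((Lc : ℝ) ^ (5 * (k + 1)))⁻¹ * (Lc : ℝ) ^ i := by
        have e' : (Lc : ℝ) ^ (5 * (k + 1)) = (Lc : ℝ) ^ ((3 + 1) * i) * (Lc : ℝ) ^ (5 * (k - i + 1)) * (Lc : ℝ) ^ i := by
          rw [← pow_add, ← pow_add]; congr 1; omega
        rw [e']; field_simp
      have hpow : (Lc : ℝ) ^ i ≤ (Lc : ℝ) ^ (i + 1) := pow_le_pow_right₀ hL1 (Nat.le_succ i)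
      calc ((Lc : ℝ) ^ ((3 + 1) * i))⁻¹ * |facePotential r Lc (legAct (legChain (respStepBmSeq (d := 3) (toSite rr) Lc) (m + i) (k - i))
              (fun μ' y => if μ' = μ then (if y = z then (1 : ℝ) else 0) else 0)) (blk (Lc ^ i) u)|
          ≤ ((Lc : ℝ) ^ ((3 + 1) * i))⁻¹ * (F * ((1 + 8 * (Lc : ℝ) * (Real.exp κ₀ + 1)) * C * ((Lc : ℝ) ^ (5 * (k - i + 1)))⁻¹ * E)) :=
            mul_le_mul_of_nonneg_left h' (by positivity)
        _ = φ1 * (Lc : ℝ) ^ i * E := by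
            rw [hφ1]
            calc ((Lc : ℝ) ^ ((3 + 1) * i))⁻¹ * (F * ((1 + 8 * (Lc : ℝ) * (Real.exp κ₀ + 1)) * C * ((Lc : ℝ) ^ (5 * (k - i + 1)))⁻¹ * E))
                = F * ((1 + 8 * (Lc : ℝ) * (Real.exp κ₀ + 1)) * C) * (((Lc : ℝ) ^ ((3 + 1) * i))⁻¹ * ((Lc : ℝ) ^ (5 * (k - i + 1)))⁻¹) * E := by ring
              _ = _ := by rw [e]; ring
        _ ≤ φ1 * (Lc : ℝ) ^ (i + 1) * E := mul_le_mul_of_nonneg_right (mul_le_mul_of_nonneg_left hpow hφ10) hE0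
  refine (abs_add_le _ _).trans ((add_le_add hA hB).trans (le_of_eq ?_))
  ring

/-- NOT IN PRINT; OUR BOOKKEEPING.  **THE PLAIN ENVELOPE OF THE CONJUGATED BOND GAUGE FUNCTION** from its staircase pieces (`2 ≤ Lc`):
`|λ′ μ z u| ≤ 2·α₁·Lc^{k+1}·e^{−κ₀‖quo (Lc^(k+1)) u − z‖∞}` (`Σ_{s ≤ k+1} Lc^s ≤ 2·Lc^{k+1}`, the OWNER's `sum_pow_le`). -/
theorem abs_combGauge_le (hLc : 2 ≤ Lc) (m k : ℕ) (μ : Fin (3 + 1)) (z u : Site (3 + 1)) :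
    |Psi (toSite rr) Lc m k (delta1 μ z) u + PsiFace r (toSite rr) Lc m k (delta1 μ z) u
        - bmGaugeAt (toSite rr) (respStep (d := 3) (Lc ^ m) (Lc ^ (m + k + 1)) μ z) Lc u|
      ≤ (2 * (8 * (Lc : ℝ) * C * ((Lc : ℝ) ^ (5 * (k + 1)))⁻¹ + F * ((1 + 8 * (Lc : ℝ) * (Real.exp κ₀ + 1)) * C * ((Lc : ℝ) ^ (5 * (k + 1)))⁻¹)) *
          (Lc : ℝ) ^ (k + 1)) * Real.exp (-(κ₀ * supNorm (quo (Lc ^ (k + 1)) u - z))) := by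
  have hL : (2 : ℝ) ≤ (Lc : ℝ) := by exact_mod_cast hLc
  have hF0 : 0 ≤ F := (faceWtSum_nonneg r Lc).trans hF
  set E := Real.exp (-(κ₀ * supNorm (quo (Lc ^ (k + 1)) u - z))) with hE
  set α : ℝ := 8 * (Lc : ℝ) * C * ((Lc : ℝ) ^ (5 * (k + 1)))⁻¹ + F * ((1 + 8 * (Lc : ℝ) * (Real.exp κ₀ + 1)) * C * ((Lc : ℝ) ^ (5 * (k + 1)))⁻¹) with hα
  have hα0 : 0 ≤ α := by positivity
  rw [combGauge_eq_staircase r (toSite rr) m k μ z u]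
  calc |∑ s ∈ Finset.range (k + 1 + 1), _|
      ≤ ∑ s ∈ Finset.range (k + 1 + 1), α * (Lc : ℝ) ^ s * E := by
        refine (Finset.abs_sum_le_sum_abs _ _).trans (Finset.sum_le_sum fun s hs => ?_)
        have h := abs_combGaugePiece_le hκ hC hN1 hr hrr hF m k μ z (Nat.lt_succ_iff.1 (Finset.mem_range.1 hs)) u
        rw [← hE] at h
        exact h
    _ = α * E * ∑ s ∈ Finset.range (k + 1 + 1), (Lc : ℝ) ^ s := by rw [Finset.mul_sum]; exact Finset.sum_congr rfl fun s _ => by ring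
    _ ≤ α * E * (2 * (Lc : ℝ) ^ (k + 1)) := mul_le_mul_of_nonneg_left (sum_pow_le hL (k + 1)) (by positivity)
    _ = (2 * α * (Lc : ℝ) ^ (k + 1)) * E := by ring

end Four

end Summit.QuantumFields.BalabanUV.Beta.GAN24.CombContactGaugeStaircase

end
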